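import Summits.QuantumFields.BalabanUV.T4Continuum.Support.B13AssemblyCoresEndSubstrateShift
import Summits.QuantumFields.BalabanUV.T4Continuum.Support.B13StepOfRecordSubstrateShiftLetters

/-!
# B13AssemblyCoresEndSubstrateShiftMeasOp — row O1-d2-ii «act instance», follower: THE (2.14)-FACTOR-CORE END OF RECORD AT THE SUBSTRATE's
# **LEVEL-SHIFTED** SLOTS OF RECORD `SubstrateSlotsOfRecordShift.slotsOfRecordShift` (W-21 = L-E15) **ON THE MEASURABLE OPERATOR CARRIER OF
# RECORD `measOp`**, the sub-slot MEMBERSHIP side conditions `hMA ∕ hMB` and the L01 reading `hT` REPLACED BY LETTER CONDITIONS BY NAME — the twin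
# of this lineage's N191 `B13AssemblyCoresEndSubstrate` (p222947) with `slotsOfRecord ↦ slotsOfRecordShift` (cell `pub-balaban`, T⁴ fan-out,
# `HOME/BINDER-OWNERS.md` row NE5; unit `b2b-balaban-t4-ne5-formalise-leaf-08`, gen 13; NE5 owner RULINGS R53 ∕ R54; journal INTENT l.20070)

HONEST FRAMING (T4-DAG PAGE 1).  Rung (B)+1 on ONE finite four-torus of fixed physical size — NOT infinite volume, NOT a mass gap, NOT
the Clay problem; `FlowStep.BetaPertH`, (B), (B^μ) do not occur here.  NE5 (`T4OutputRate.NE5`) is NOT PRINTED and NOT PROVED (spine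
0/9, unchanged): the END below is an IMPLICATION from displayed binders — «NE5 ⇐ the shifted instance» (trigger c5), NOT «NE5 proved».  The
O1 INSTANCE and its level shift are the SUBSTRATE cell's (Q-NE9-O1, DESIGN RULE R34, W-21); this file APPLIES landed faces BY NAME at it (CLAIM
RULE 3 ∕ 7 (b): not re-wiring) and asserts NOTHING about the substrate's letters.  0 cite tags; printed KIND only; 0 `def`.  HONEST DEPENDENCY
(cell, verbatim): continuum YM on T⁴ ⇐ BetaPertH ∧ nine spine estimates (0/9 proved); BetaPertH ⇐ (D1) ∧ (D4) ∧ CAP+tail; G-an2-4 gates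
asym, D1 and NE2/3/4.

WHAT THIS MODULE IS (bookkeeping ∕ [folklore]; applications BY NAME; no estimate):
* §1 **`ne5_substrateShift_cores_actNorm`** — this lineage's `B13AssemblyCoresEndSubstrateShift.ne5_slotsOfRecordShift_cores_actNorm` (N184
  §2's twin at the shifted slots) AT THE SUB-SLOT OF RECORD `M := B13OpMeasurable.measOp` (owner R20), with `hMA ∕ hMB :=`
  `opA_mem_measOp_slotsOfRecordShift ∕ opB_mem_measOp_slotsOfRecordShift` (p221190 §1's six LETTER conditions `hbdA hmQA hmRA hbdB hmQB hmRB`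
  at the shifted slots — run B's format-boundedness `hbdB` is now about `rawBOfRecordShift`, run A's three are untouched) and `hT :=`
  `transportReads_slotsOfRecordShift_of_factor` (p221190 §2's factorisation datum `(iopAt, hiopA)`; the insertion datum is untouched by the shift);
  the scalar letters read off `L` (`L.rOp`, `L.rHist`, `L.ins.ω` — `rfl` through W-21's structure update); EVERY OTHER BINDER of N191 §1 VERBATIM
  with `slotsOfRecord ↦ slotsOfRecordShift`; conclusion LITERALLY `T4OutputRate.NE5 (B13StepOfRecord.outA (slotsOfRecordShift …) E₀ cB)
  (B13StepOfRecord.outB (slotsOfRecordShift …) E₀ cB) W κ θ′ C₅`, the diamond's `C₅` VERBATIM.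
* §2 **`exists_ne5_substrateShift_cores_actNorm`** — the chained face (arithmetic letters eliminated) the same way ⟹ `∃ C₅, NE5 …`.
CENSUS vs N191 §1 ∕ §2 (binders, by name): MINUS = ∅; PLUS = ∅; statements = N191's with `slotsOfRecord ↦ slotsOfRecordShift` and, inside
`hbdB`, `rawBOfRecord ι D … ↦ rawBOfRecordShift D ι …`.  The W1 binder `hwer` at the shifted slots compares run A's depth-`k` species with run
B's depth-`(k+1)` covariance — rows NE2 ∧ NE3's two-level rate (R53 (3)), DISPLAYED; the W1-PRODUCED twins of p229718 ∕ p229762 follow the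
substrate's L-E9b face `SubstrateO1ReadingsShift` in their own module.
STATUS (census, Edison rule).  DISPLAYED at the shifted instance on `measOp`: everything listed under §1.  NOTHING of Bałaban's (2.14) data is
asserted; 0/12 leaves; NE5 NOT PROVED; spine 0/9; rung (B)+1 finite T⁴; NOT infinite volume ∕ mass gap ∕ Clay.  0 sorry; axioms ⊆
{propext, Classical.choice, Quot.sound}.
-/

noncomputable section

open scoped BigOperators
open Metric MeasureTheory

namespace Summit.QuantumFields.BalabanUV.T4Continuum.B13AssemblyCoresEndSubstrateShiftMeasOp

open Literature.MathematicalPhysics.QuantumFieldTheory.Balaban1983to89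
open Literature.MathematicalPhysics.QuantumFieldTheory.Balaban1983to89.T4OutputRate (DecayBound NE5)
open Literature.MathematicalPhysics.QuantumFieldTheory.Balaban1983to89.B5Prop11Plancherel (Tor)
open Summit.QuantumFields.BalabanUV.T4Continuum.B13OpDatum (OpDatum FormatBounded)
open Summit.QuantumFields.BalabanUV.T4Continuum.B13OpDatumJunctions (opOf RawBounded WeightedEntrywiseRate)
open Summit.QuantumFields.BalabanUV.T4Continuum.B13OpMeasurable (measOp)
open Summit.QuantumFields.BalabanUV.T4Continuum.B13StepTermLabels (InnerLabel)
open Summit.QuantumFields.BalabanUV.T4Continuum.B13InnerData (Bnd b13InnerData)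
open Summit.QuantumFields.BalabanUV.T4Continuum.B13HistMeasurable (MeasPotFrame B13HistM)
open Summit.QuantumFields.BalabanUV.T4Continuum.B13TermCoreFamily (factorCores)
open Summit.QuantumFields.BalabanUV.T4Continuum.B13TermCoreMass (factorMass)
open Summit.QuantumFields.BalabanUV.T4Continuum.UrsellTreeSum (ind)
open Summit.QuantumFields.BalabanUV.T4Continuum.UrsellTermBudget (actSum)
open Summit.QuantumFields.BalabanUV.T4Continuum.B13DomainGeometryTR (SCube footprint)
open Summit.QuantumFields.BalabanUV.T4Continuum.B13StepOfRecord (assembly step)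
open Summit.QuantumFields.BalabanUV.T4Continuum.SubstrateBackgroundTransporters (unitMod)
open Summit.QuantumFields.BalabanUV.T4Continuum.SubstrateTwoRunsDriven (DrivenRuns)
open Summit.QuantumFields.BalabanUV.T4Continuum.SubstrateRawSpecies (rawAOfRecord rawBOfRecord)
open Summit.QuantumFields.BalabanUV.T4Continuum.SubstrateSlotsOfRecordShift (rawBOfRecordShift slotsOfRecordShift)
open Summit.QuantumFields.BalabanUV.T4Continuum.SubstrateSlotsOfRecord (SpeciesRec SlotLetters slotsOfRecord)
open Summit.QuantumFields.BalabanUV.T4Continuum.B13AssemblyCoresEndRestrictRecord (coresRec)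
open Summit.QuantumFields.BalabanUV.T4Continuum.B13AssemblyCoresEndSubstrateShift (ne5_slotsOfRecordShift_cores_actNorm
  exists_ne5_slotsOfRecordShift_cores_actNorm)
open Summit.QuantumFields.BalabanUV.T4Continuum.B13StepOfRecordSubstrateShiftLetters (opA_mem_measOp_slotsOfRecordShift opB_mem_measOp_slotsOfRecordShift
  transportReads_slotsOfRecordShift_of_factor)

variable {G : Type} [GaugeGroup G] (D : DrivenRuns G)
variable {o : Type} [Fintype o] [DecidableEq o] (ι : G →* Matrix o o ℂ) (c : ℂ) (a : ℝ) (s : ℕ → ℂ)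
variable {T ι' S Ω 𝒴 : Type} [MeasurableSpace Ω] (P : MeasPotFrame D.carriers) {IOp : Type*}
  (𝒵 : D.carriers.Dom → InnerLabel D.carriers.Dom (Bnd D.toTwoRuns) → Type) [∀ Z j, Fintype (𝒵 Z j)] (dom : ∀ Z j, 𝒵 Z j → D.carriers.Dom)
  (Jc : D.carriers.Dom → InnerLabel D.carriers.Dom (Bnd D.toTwoRuns) → Type) [∀ Z j, Fintype (Jc Z j)]
  (V : D.carriers.Dom → InnerLabel D.carriers.Dom (Bnd D.toTwoRuns) → Type) [∀ Z j, NormedAddCommGroup (V Z j)]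
  [∀ Z j, InnerProductSpace ℝ (V Z j)] [∀ Z j, MeasurableSpace (V Z j)] [∀ Z j, BorelSpace (V Z j)] [∀ Z j, FiniteDimensional ℝ (V Z j)]
  (mI : D.carriers.Dom → InnerLabel D.carriers.Dom (Bnd D.toTwoRuns) → Type) [∀ Z j, Fintype (mI Z j)] [∀ Z j, DecidableEq (mI Z j)]
  (L : SlotLetters D (o := o) (T := T) (ι' := ι') (S := S) (Ω := Ω) (𝒴 := 𝒴) P (IOp := IOp) 𝒵 dom Jc V mI)

section Instance

variable
  -- p221190 §1's letter conditions (replace `hMA` ∕ `hMB` at `M := measOp`)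
  (hbdA : ∀ (g : ℕ → ℝ) (U : D.carriers.BgA) (k : ℕ),
    FormatBounded (L.W k).format (rawAOfRecord ι D c a s L.ΓA L.dkA L.gcA L.pQA L.pRA g U k).kernel)
  (hmQA : ∀ (r : ℝ) (U : GaugeField (D.F.P D.K) 0 G) (k : ℕ) (Y : 𝒴) (b b' : ((Tor (unitMod (D.F.P D.K)) × Fin (D.F.P D.K).d) × o)),
    Measurable fun x : Ω => L.pQA r U k x Y b b')
  (hmRA : ∀ (r : ℝ) (U : GaugeField (D.F.P D.K) 0 G) (k : ℕ) (Y : 𝒴), Measurable fun x : Ω => L.pRA r U k x Y)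
  (hbdB : ∀ (g : ℕ → ℝ) (U : D.carriers.BgB) (k : ℕ),
    FormatBounded (L.W k).format (rawBOfRecordShift D ι c a s L.ΓB L.dkB L.gcB L.pQB L.pRB g U k).kernel)
  (hmQB : ∀ (r : ℝ) (U : GaugeField (D.F.P (D.K + 1)) 0 G) (k : ℕ) (Y : 𝒴) (b b' : ((Tor (unitMod (D.F.P D.K)) × Fin (D.F.P D.K).d) × o)),
    Measurable fun x : Ω => L.pQB r U k x Y b b')
  (hmRB : ∀ (r : ℝ) (U : GaugeField (D.F.P (D.K + 1)) 0 G) (k : ℕ) (Y : 𝒴), Measurable fun x : Ω => L.pRB r U k x Y)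
  -- p221190 §2's factorisation datum (replaces `hT`)
  (iopAt : ℝ → D.carriers.BgA → ℕ → IOp)
  (hiopA : ∀ (r : ℝ) (U : D.carriers.BgB) (k : ℕ), L.ins.iopA r U k = iopAt r (D.carriers.transport U) k)
  (E₀ cB : ℝ)

/-! ## §1 The (2.14)-factor-core END of record at the substrate's LEVEL-SHIFTED slots of record on `measOp` -/

include hbdA hmQA hmRA hiopA in
/-- [folklore] **THE (2.14)-FACTOR-CORE END OF RECORD AT THE SUBSTRATE's LEVEL-SHIFTED SLOTS OF RECORD ON THE MEASURABLE OPERATOR CARRIER** —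
`B13AssemblyCoresEndSubstrateShift.ne5_slotsOfRecordShift_cores_actNorm` (N184 §2's twin at `slotsOfRecordShift`) at `M := measOp …`, `hMA ∕ hMB :=`
`opA_mem_measOp_slotsOfRecordShift ∕ opB_mem_measOp_slotsOfRecordShift` (p221190 §1's six LETTER conditions at the shifted slots; run B's
format-boundedness is about `rawBOfRecordShift`), `hT := transportReads_slotsOfRecordShift_of_factor` (p221190 §2's factorisation datum
`(iopAt, hiopA)`; run A's side and the insertion datum are untouched by the shift).  Binders (all DISPLAYED, in p221018's order): the
slice budgets, the levels of the instance's outputs, W1 in row NE2's entry currency + floor, W4, rooms, the factor letters on the `measOp`-balls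
about run B's SHIFTED datum of record (= the substrate's `gaussN ∕ gaussQ ∘ linForm` clauses by `coresRec_N ∕ _q`), the history radius, `A′` ∕
decay split ∕ `Φ′`, sizes.  Conclusion LITERALLY `T4OutputRate.NE5
(B13StepOfRecord.outA (slotsOfRecordShift …) E₀ cB) (B13StepOfRecord.outB (slotsOfRecordShift …) E₀ cB) W κ θ′ C₅`, the diamond's `C₅`.
«NE5 ⇐ the shifted instance» — NOT NE5 proved; no letter of the substrate asserted; `hwer` compares run A's depth-`k` species with run B's
depth-`(k+1)` covariance (rows NE2 ∧ NE3's two-level rate, R53 (3)), DISPLAYED. -/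
theorem ne5_substrateShift_cores_actNorm {W : Set (ℕ → ℝ)} {ROp RHist R' H : ℕ → ℝ}
    {N₀f mf bf : D.carriers.Dom → InnerLabel D.carriers.Dom (Bnd D.toTwoRuns) → ℝ}
    {A' : ℕ → D.carriers.Dom → InnerLabel D.carriers.Dom (Bnd D.toTwoRuns) → ℝ}
    {mstar κ Φ' EA₀ E₁ cA c₁ r₀ δ' θ θ' ρ₀ B : ℝ} {k₀ : ℕ}
    (hbB : (assembly (slotsOfRecordShift D ι c a s P 𝒵 dom Jc V mI L)).SliceBudgetB W κ cB)
    (hbA : (slotsOfRecordShift D ι c a s P 𝒵 dom Jc V mI L).D.SliceBudget (step (slotsOfRecordShift D ι c a s P 𝒵 dom Jc V mI L) E₀ cB) W κ cA)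
    (hdA : DecayBound (B13StepOfRecord.outA (slotsOfRecordShift D ι c a s P 𝒵 dom Jc V mI L) E₀ cB) W EA₀ κ)
    (hdB : DecayBound (B13StepOfRecord.outB (slotsOfRecordShift D ι c a s P 𝒵 dom Jc V mI L) E₀ cB) W E₀ κ)
    (hRA : RawBounded (slotsOfRecordShift D ι c a s P 𝒵 dom Jc V mI L).F (assembly (slotsOfRecordShift D ι c a s P 𝒵 dom Jc V mI L)).rawAt W)
    (hRB : RawBounded (slotsOfRecordShift D ι c a s P 𝒵 dom Jc V mI L).F (slotsOfRecordShift D ι c a s P 𝒵 dom Jc V mI L).rawB W)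
    (hwer : WeightedEntrywiseRate (slotsOfRecordShift D ι c a s P 𝒵 dom Jc V mI L).F (assembly (slotsOfRecordShift D ι c a s P 𝒵 dom Jc V mI L)).rawAt
      (slotsOfRecordShift D ι c a s P 𝒵 dom Jc V mI L).rawB W c₁ fun k => θ ^ k)
    (hfl : ∀ k, r₀ ≤ L.rOp k)
    (hins : (step (slotsOfRecordShift D ι c a s P 𝒵 dom Jc V mI L) E₀ cB).InsertionRate W κ E₀ δ' θ)
    (hOp : ∀ k, L.rOp k ≤ ROp k) (hroom : ∀ k, ROp k < R' k)
    (hHist : ∀ k, (assembly (slotsOfRecordShift D ι c a s P 𝒵 dom Jc V mI L)).bHist E₀ cB k + L.rHist k ≤ RHist k)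
    -- the factor letters in the substrate's currency, on the `measOp`-balls
    (hm : 0 < mstar) (hmf : ∀ Z ℓ, mstar ≤ mf Z ℓ) (hN₀ : ∀ Z ℓ, 0 ≤ N₀f Z ℓ)
    (hNf : ∀ k, ∀ g ∈ W, ∀ (U : D.carriers.BgB) (X : D.carriers.Dom), D.carriers.scale X = k →
      ∀ i, (assembly (slotsOfRecordShift D ι c a s P 𝒵 dom Jc V mI L)).𝒯.Rel k i X →
      ∀ m : Fin ((assembly (slotsOfRecordShift D ι c a s P 𝒵 dom Jc V mI L)).𝒯.len i + 1),
      (∀ op ∈ ball (⟨opOf (slotsOfRecordShift D ι c a s P 𝒵 dom Jc V mI L).F (slotsOfRecordShift D ι c a s P 𝒵 dom Jc V mI L).rawB g U k,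
          opB_mem_measOp_slotsOfRecordShift D ι c a s P 𝒵 dom Jc V mI L hbdB hmQB hmRB g U k⟩ :
            measOp T ((Tor (unitMod (D.F.P D.K)) × Fin (D.F.P D.K).d) × o) ι' Ω 𝒴) (R' k),
        AEStronglyMeasurable ((factorCores (assembly (slotsOfRecordShift D ι c a s P 𝒵 dom Jc V mI L)).𝒯 (coresRec D P 𝒵 dom Jc V mI L) i m).N
          (op : OpDatum _)) (factorCores (assembly (slotsOfRecordShift D ι c a s P 𝒵 dom Jc V mI L)).𝒯 (coresRec D P 𝒵 dom Jc V mI L) i m).lam) ∧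
      (∀ p, DifferentiableOn ℂ (fun op : measOp T ((Tor (unitMod (D.F.P D.K)) × Fin (D.F.P D.K).d) × o) ι' Ω 𝒴 =>
          (factorCores (assembly (slotsOfRecordShift D ι c a s P 𝒵 dom Jc V mI L)).𝒯 (coresRec D P 𝒵 dom Jc V mI L) i m).N (op : OpDatum _) p)
        (ball (⟨opOf (slotsOfRecordShift D ι c a s P 𝒵 dom Jc V mI L).F (slotsOfRecordShift D ι c a s P 𝒵 dom Jc V mI L).rawB g U k,
          opB_mem_measOp_slotsOfRecordShift D ι c a s P 𝒵 dom Jc V mI L hbdB hmQB hmRB g U k⟩ :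
            measOp T ((Tor (unitMod (D.F.P D.K)) × Fin (D.F.P D.K).d) × o) ι' Ω 𝒴) (R' k))) ∧
      (∀ op ∈ ball (⟨opOf (slotsOfRecordShift D ι c a s P 𝒵 dom Jc V mI L).F (slotsOfRecordShift D ι c a s P 𝒵 dom Jc V mI L).rawB g U k,
          opB_mem_measOp_slotsOfRecordShift D ι c a s P 𝒵 dom Jc V mI L hbdB hmQB hmRB g U k⟩ :
            measOp T ((Tor (unitMod (D.F.P D.K)) × Fin (D.F.P D.K).d) × o) ι' Ω 𝒴) (R' k), ∀ p,
        ‖(factorCores (assembly (slotsOfRecordShift D ι c a s P 𝒵 dom Jc V mI L)).𝒯 (coresRec D P 𝒵 dom Jc V mI L) i m).N (op : OpDatum _) p‖ ≤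
          N₀f ((assembly (slotsOfRecordShift D ι c a s P 𝒵 dom Jc V mI L)).𝒯.poly i m)
            ((assembly (slotsOfRecordShift D ι c a s P 𝒵 dom Jc V mI L)).𝒯.lab i m)))
    (hqf : ∀ k, ∀ g ∈ W, ∀ (U : D.carriers.BgB) (X : D.carriers.Dom), D.carriers.scale X = k →
      ∀ i, (assembly (slotsOfRecordShift D ι c a s P 𝒵 dom Jc V mI L)).𝒯.Rel k i X →
      ∀ m : Fin ((assembly (slotsOfRecordShift D ι c a s P 𝒵 dom Jc V mI L)).𝒯.len i + 1),
      (∀ op ∈ ball (⟨opOf (slotsOfRecordShift D ι c a s P 𝒵 dom Jc V mI L).F (slotsOfRecordShift D ι c a s P 𝒵 dom Jc V mI L).rawB g U k,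
          opB_mem_measOp_slotsOfRecordShift D ι c a s P 𝒵 dom Jc V mI L hbdB hmQB hmRB g U k⟩ :
            measOp T ((Tor (unitMod (D.F.P D.K)) × Fin (D.F.P D.K).d) × o) ι' Ω 𝒴) (R' k),
        AEStronglyMeasurable (Function.uncurry
          ((factorCores (assembly (slotsOfRecordShift D ι c a s P 𝒵 dom Jc V mI L)).𝒯 (coresRec D P 𝒵 dom Jc V mI L) i m).q (op : OpDatum _)))
          ((factorCores (assembly (slotsOfRecordShift D ι c a s P 𝒵 dom Jc V mI L)).𝒯 (coresRec D P 𝒵 dom Jc V mI L) i m).lam.prod volume)) ∧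
      (∀ p v, DifferentiableOn ℂ (fun op : measOp T ((Tor (unitMod (D.F.P D.K)) × Fin (D.F.P D.K).d) × o) ι' Ω 𝒴 =>
          (factorCores (assembly (slotsOfRecordShift D ι c a s P 𝒵 dom Jc V mI L)).𝒯 (coresRec D P 𝒵 dom Jc V mI L) i m).q (op : OpDatum _) p v)
        (ball (⟨opOf (slotsOfRecordShift D ι c a s P 𝒵 dom Jc V mI L).F (slotsOfRecordShift D ι c a s P 𝒵 dom Jc V mI L).rawB g U k,
          opB_mem_measOp_slotsOfRecordShift D ι c a s P 𝒵 dom Jc V mI L hbdB hmQB hmRB g U k⟩ :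
            measOp T ((Tor (unitMod (D.F.P D.K)) × Fin (D.F.P D.K).d) × o) ι' Ω 𝒴) (R' k))) ∧
      (∀ op ∈ ball (⟨opOf (slotsOfRecordShift D ι c a s P 𝒵 dom Jc V mI L).F (slotsOfRecordShift D ι c a s P 𝒵 dom Jc V mI L).rawB g U k,
          opB_mem_measOp_slotsOfRecordShift D ι c a s P 𝒵 dom Jc V mI L hbdB hmQB hmRB g U k⟩ :
            measOp T ((Tor (unitMod (D.F.P D.K)) × Fin (D.F.P D.K).d) × o) ι' Ω 𝒴) (R' k), ∀ p v,
        mf ((assembly (slotsOfRecordShift D ι c a s P 𝒵 dom Jc V mI L)).𝒯.poly i m) ((assembly (slotsOfRecordShift D ι c a s P 𝒵 dom Jc V mI L)).𝒯.lab i m) *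
            ‖v‖ ^ 2 -
          bf ((assembly (slotsOfRecordShift D ι c a s P 𝒵 dom Jc V mI L)).𝒯.poly i m) ((assembly (slotsOfRecordShift D ι c a s P 𝒵 dom Jc V mI L)).𝒯.lab i m) ≤
          ((factorCores (assembly (slotsOfRecordShift D ι c a s P 𝒵 dom Jc V mI L)).𝒯 (coresRec D P 𝒵 dom Jc V mI L) i m).q (op : OpDatum _) p v).re))
    (hH : ∀ k, ∀ g ∈ W, ∀ U : D.carriers.BgB, ‖(assembly (slotsOfRecordShift D ι c a s P 𝒵 dom Jc V mI L)).histRef g U k‖ + RHist k ≤ H k)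
    -- the stripped majorant's decay split and anchored exponential norm
    (hκ : 0 ≤ κ) (hA0' : ∀ k Z ℓ, 0 ≤ A' k Z ℓ)
    (hdec : ∀ k Z ℓ, factorMass (coresRec D P 𝒵 dom Jc V mI L) N₀f bf mstar (H k) Z ℓ ≤ A' k Z ℓ * Real.exp (-(κ * (D.carriers.d Z + 5))))
    (hΦ0 : 0 ≤ Φ') (hsmallΦ : 36 * Φ' < 1)
    (hΦ : ∀ (k : ℕ) (q : SCube D.toTwoRuns), ∑ Z ∈ D.toTwoRuns.domAt k,
      ind (q ∈ footprint Z) * actSum (b13InnerData D.toTwoRuns) (A' k) k Z * Real.exp ((footprint Z).card) ≤ Φ')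
    (hE₀ : 0 ≤ E₀) (hE₁ : 0 < E₁) (hcA : 0 ≤ cA) (hcB : 0 ≤ cB) (hc₁ : 0 ≤ c₁) (hr₀ : 0 < r₀) (hδ' : 0 ≤ δ')
    (hθ : 0 ≤ θ) (hθθ' : θ ≤ θ') (hθ'1 : θ' ≤ 1) (hω : 0 < L.ins.ω) (hω1 : L.ins.ω < 1) (hρ₀ : ρ₀ < 1)
    (hnear : (c₁ / r₀ + δ') * θ ^ k₀ + cA * (EA₀ + E₀) / (1 - L.ins.ω) ≤ ρ₀) (hB : 0 ≤ B)
    (hfirst : ∀ k < k₀, EA₀ + E₀ ≤ B * θ ^ k)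
    (hsmall : L.ins.ω + Φ' / (1 - 36 * Φ') / (1 - ρ₀) * cA < θ') :
    NE5 (B13StepOfRecord.outA (slotsOfRecordShift D ι c a s P 𝒵 dom Jc V mI L) E₀ cB)
      (B13StepOfRecord.outB (slotsOfRecordShift D ι c a s P 𝒵 dom Jc V mI L) E₀ cB) W κ θ'
      ((Φ' / (1 - 36 * Φ') / (1 - ρ₀) * (c₁ / r₀) + Φ' / (1 - 36 * Φ') / (1 - ρ₀) * δ' + B) * (θ' - L.ins.ω) /
        (θ' - (L.ins.ω + Φ' / (1 - 36 * Φ') / (1 - ρ₀) * cA))) :=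
  ne5_slotsOfRecordShift_cores_actNorm D ι c a s P 𝒵 dom Jc V mI L
    (measOp T ((Tor (unitMod (D.F.P D.K)) × Fin (D.F.P D.K).d) × o) ι' Ω 𝒴)
    (opA_mem_measOp_slotsOfRecordShift D ι c a s P 𝒵 dom Jc V mI L hbdA hmQA hmRA)
    (opB_mem_measOp_slotsOfRecordShift D ι c a s P 𝒵 dom Jc V mI L hbdB hmQB hmRB) E₀ cB
    (transportReads_slotsOfRecordShift_of_factor D ι c a s P 𝒵 dom Jc V mI L iopAt hiopA W) hbB hbA hdA hdB hRA hRB hwer hfl hins hOp hroom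
    hHist hm hmf hN₀ hNf hqf hH hκ hA0' hdec hΦ0 hsmallΦ hΦ hE₀ hE₁ hcA hcB hc₁ hr₀ hδ' hθ hθθ' hθ'1 hω hω1 hρ₀ hnear hB hfirst hsmall

/-! ## §2 The chained face at the substrate's LEVEL-SHIFTED slots of record on `measOp` -/

include hbdA hmQA hmRA hiopA in
/-- [folklore] **THE CHAINED (2.14)-FACTOR-CORE END OF RECORD AT THE SUBSTRATE's LEVEL-SHIFTED SLOTS OF RECORD ON `measOp`** —
`B13AssemblyCoresEndSubstrateShift.exists_ne5_slotsOfRecordShift_cores_actNorm` (N184 §3's twin — p221018 §3: arithmetic letters eliminated — `0 < θ < 1`,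
`cA(EA₀ + E₀) < 1 − ω`, `ω + (Φ′∕(1 − 36Φ′))·cA·(1 − ω)∕(1 − ω − cA(EA₀ + E₀)) < θ′`) at `M := measOp …`, `hMA ∕ hMB ∕ hT` replaced by p221190's
letter conditions (at the shifted slots) and factorisation datum ⟹ `∃ C₅, NE5 (B13StepOfRecord.outA (slotsOfRecordShift …) E₀ cB)
(B13StepOfRecord.outB (slotsOfRecordShift …) E₀ cB) W κ θ′ C₅`.  «NE5 ⇐ the shifted instance». -/
theorem exists_ne5_substrateShift_cores_actNorm {W : Set (ℕ → ℝ)} {ROp RHist R' H : ℕ → ℝ}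
    {N₀f mf bf : D.carriers.Dom → InnerLabel D.carriers.Dom (Bnd D.toTwoRuns) → ℝ}
    {A' : ℕ → D.carriers.Dom → InnerLabel D.carriers.Dom (Bnd D.toTwoRuns) → ℝ}
    {mstar κ Φ' EA₀ cA c₁ r₀ δ' θ θ' : ℝ}
    (hbB : (assembly (slotsOfRecordShift D ι c a s P 𝒵 dom Jc V mI L)).SliceBudgetB W κ cB)
    (hbA : (slotsOfRecordShift D ι c a s P 𝒵 dom Jc V mI L).D.SliceBudget (step (slotsOfRecordShift D ι c a s P 𝒵 dom Jc V mI L) E₀ cB) W κ cA)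
    (hdA : DecayBound (B13StepOfRecord.outA (slotsOfRecordShift D ι c a s P 𝒵 dom Jc V mI L) E₀ cB) W EA₀ κ)
    (hdB : DecayBound (B13StepOfRecord.outB (slotsOfRecordShift D ι c a s P 𝒵 dom Jc V mI L) E₀ cB) W E₀ κ)
    (hRA : RawBounded (slotsOfRecordShift D ι c a s P 𝒵 dom Jc V mI L).F (assembly (slotsOfRecordShift D ι c a s P 𝒵 dom Jc V mI L)).rawAt W)
    (hRB : RawBounded (slotsOfRecordShift D ι c a s P 𝒵 dom Jc V mI L).F (slotsOfRecordShift D ι c a s P 𝒵 dom Jc V mI L).rawB W)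
    (hwer : WeightedEntrywiseRate (slotsOfRecordShift D ι c a s P 𝒵 dom Jc V mI L).F (assembly (slotsOfRecordShift D ι c a s P 𝒵 dom Jc V mI L)).rawAt
      (slotsOfRecordShift D ι c a s P 𝒵 dom Jc V mI L).rawB W c₁ fun k => θ ^ k)
    (hfl : ∀ k, r₀ ≤ L.rOp k)
    (hins : (step (slotsOfRecordShift D ι c a s P 𝒵 dom Jc V mI L) E₀ cB).InsertionRate W κ E₀ δ' θ)
    (hOp : ∀ k, L.rOp k ≤ ROp k) (hroom : ∀ k, ROp k < R' k)
    (hHist : ∀ k, (assembly (slotsOfRecordShift D ι c a s P 𝒵 dom Jc V mI L)).bHist E₀ cB k + L.rHist k ≤ RHist k)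
    (hm : 0 < mstar) (hmf : ∀ Z ℓ, mstar ≤ mf Z ℓ) (hN₀ : ∀ Z ℓ, 0 ≤ N₀f Z ℓ)
    (hNf : ∀ k, ∀ g ∈ W, ∀ (U : D.carriers.BgB) (X : D.carriers.Dom), D.carriers.scale X = k →
      ∀ i, (assembly (slotsOfRecordShift D ι c a s P 𝒵 dom Jc V mI L)).𝒯.Rel k i X →
      ∀ m : Fin ((assembly (slotsOfRecordShift D ι c a s P 𝒵 dom Jc V mI L)).𝒯.len i + 1),
      (∀ op ∈ ball (⟨opOf (slotsOfRecordShift D ι c a s P 𝒵 dom Jc V mI L).F (slotsOfRecordShift D ι c a s P 𝒵 dom Jc V mI L).rawB g U k,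
          opB_mem_measOp_slotsOfRecordShift D ι c a s P 𝒵 dom Jc V mI L hbdB hmQB hmRB g U k⟩ :
            measOp T ((Tor (unitMod (D.F.P D.K)) × Fin (D.F.P D.K).d) × o) ι' Ω 𝒴) (R' k),
        AEStronglyMeasurable ((factorCores (assembly (slotsOfRecordShift D ι c a s P 𝒵 dom Jc V mI L)).𝒯 (coresRec D P 𝒵 dom Jc V mI L) i m).N
          (op : OpDatum _)) (factorCores (assembly (slotsOfRecordShift D ι c a s P 𝒵 dom Jc V mI L)).𝒯 (coresRec D P 𝒵 dom Jc V mI L) i m).lam) ∧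
      (∀ p, DifferentiableOn ℂ (fun op : measOp T ((Tor (unitMod (D.F.P D.K)) × Fin (D.F.P D.K).d) × o) ι' Ω 𝒴 =>
          (factorCores (assembly (slotsOfRecordShift D ι c a s P 𝒵 dom Jc V mI L)).𝒯 (coresRec D P 𝒵 dom Jc V mI L) i m).N (op : OpDatum _) p)
        (ball (⟨opOf (slotsOfRecordShift D ι c a s P 𝒵 dom Jc V mI L).F (slotsOfRecordShift D ι c a s P 𝒵 dom Jc V mI L).rawB g U k,
          opB_mem_measOp_slotsOfRecordShift D ι c a s P 𝒵 dom Jc V mI L hbdB hmQB hmRB g U k⟩ :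
            measOp T ((Tor (unitMod (D.F.P D.K)) × Fin (D.F.P D.K).d) × o) ι' Ω 𝒴) (R' k))) ∧
      (∀ op ∈ ball (⟨opOf (slotsOfRecordShift D ι c a s P 𝒵 dom Jc V mI L).F (slotsOfRecordShift D ι c a s P 𝒵 dom Jc V mI L).rawB g U k,
          opB_mem_measOp_slotsOfRecordShift D ι c a s P 𝒵 dom Jc V mI L hbdB hmQB hmRB g U k⟩ :
            measOp T ((Tor (unitMod (D.F.P D.K)) × Fin (D.F.P D.K).d) × o) ι' Ω 𝒴) (R' k), ∀ p,
        ‖(factorCores (assembly (slotsOfRecordShift D ι c a s P 𝒵 dom Jc V mI L)).𝒯 (coresRec D P 𝒵 dom Jc V mI L) i m).N (op : OpDatum _) p‖ ≤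
          N₀f ((assembly (slotsOfRecordShift D ι c a s P 𝒵 dom Jc V mI L)).𝒯.poly i m)
            ((assembly (slotsOfRecordShift D ι c a s P 𝒵 dom Jc V mI L)).𝒯.lab i m)))
    (hqf : ∀ k, ∀ g ∈ W, ∀ (U : D.carriers.BgB) (X : D.carriers.Dom), D.carriers.scale X = k →
      ∀ i, (assembly (slotsOfRecordShift D ι c a s P 𝒵 dom Jc V mI L)).𝒯.Rel k i X →
      ∀ m : Fin ((assembly (slotsOfRecordShift D ι c a s P 𝒵 dom Jc V mI L)).𝒯.len i + 1),
      (∀ op ∈ ball (⟨opOf (slotsOfRecordShift D ι c a s P 𝒵 dom Jc V mI L).F (slotsOfRecordShift D ι c a s P 𝒵 dom Jc V mI L).rawB g U k,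
          opB_mem_measOp_slotsOfRecordShift D ι c a s P 𝒵 dom Jc V mI L hbdB hmQB hmRB g U k⟩ :
            measOp T ((Tor (unitMod (D.F.P D.K)) × Fin (D.F.P D.K).d) × o) ι' Ω 𝒴) (R' k),
        AEStronglyMeasurable (Function.uncurry
          ((factorCores (assembly (slotsOfRecordShift D ι c a s P 𝒵 dom Jc V mI L)).𝒯 (coresRec D P 𝒵 dom Jc V mI L) i m).q (op : OpDatum _)))
          ((factorCores (assembly (slotsOfRecordShift D ι c a s P 𝒵 dom Jc V mI L)).𝒯 (coresRec D P 𝒵 dom Jc V mI L) i m).lam.prod volume)) ∧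
      (∀ p v, DifferentiableOn ℂ (fun op : measOp T ((Tor (unitMod (D.F.P D.K)) × Fin (D.F.P D.K).d) × o) ι' Ω 𝒴 =>
          (factorCores (assembly (slotsOfRecordShift D ι c a s P 𝒵 dom Jc V mI L)).𝒯 (coresRec D P 𝒵 dom Jc V mI L) i m).q (op : OpDatum _) p v)
        (ball (⟨opOf (slotsOfRecordShift D ι c a s P 𝒵 dom Jc V mI L).F (slotsOfRecordShift D ι c a s P 𝒵 dom Jc V mI L).rawB g U k,
          opB_mem_measOp_slotsOfRecordShift D ι c a s P 𝒵 dom Jc V mI L hbdB hmQB hmRB g U k⟩ :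
            measOp T ((Tor (unitMod (D.F.P D.K)) × Fin (D.F.P D.K).d) × o) ι' Ω 𝒴) (R' k))) ∧
      (∀ op ∈ ball (⟨opOf (slotsOfRecordShift D ι c a s P 𝒵 dom Jc V mI L).F (slotsOfRecordShift D ι c a s P 𝒵 dom Jc V mI L).rawB g U k,
          opB_mem_measOp_slotsOfRecordShift D ι c a s P 𝒵 dom Jc V mI L hbdB hmQB hmRB g U k⟩ :
            measOp T ((Tor (unitMod (D.F.P D.K)) × Fin (D.F.P D.K).d) × o) ι' Ω 𝒴) (R' k), ∀ p v,
        mf ((assembly (slotsOfRecordShift D ι c a s P 𝒵 dom Jc V mI L)).𝒯.poly i m) ((assembly (slotsOfRecordShift D ι c a s P 𝒵 dom Jc V mI L)).𝒯.lab i m) *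
            ‖v‖ ^ 2 -
          bf ((assembly (slotsOfRecordShift D ι c a s P 𝒵 dom Jc V mI L)).𝒯.poly i m) ((assembly (slotsOfRecordShift D ι c a s P 𝒵 dom Jc V mI L)).𝒯.lab i m) ≤
          ((factorCores (assembly (slotsOfRecordShift D ι c a s P 𝒵 dom Jc V mI L)).𝒯 (coresRec D P 𝒵 dom Jc V mI L) i m).q (op : OpDatum _) p v).re))
    (hH : ∀ k, ∀ g ∈ W, ∀ U : D.carriers.BgB, ‖(assembly (slotsOfRecordShift D ι c a s P 𝒵 dom Jc V mI L)).histRef g U k‖ + RHist k ≤ H k)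
    (hκ : 0 ≤ κ) (hA0' : ∀ k Z ℓ, 0 ≤ A' k Z ℓ)
    (hdec : ∀ k Z ℓ, factorMass (coresRec D P 𝒵 dom Jc V mI L) N₀f bf mstar (H k) Z ℓ ≤ A' k Z ℓ * Real.exp (-(κ * (D.carriers.d Z + 5))))
    (hΦ0 : 0 ≤ Φ') (hsmallΦ : 36 * Φ' < 1)
    (hΦ : ∀ (k : ℕ) (q : SCube D.toTwoRuns), ∑ Z ∈ D.toTwoRuns.domAt k,
      ind (q ∈ footprint Z) * actSum (b13InnerData D.toTwoRuns) (A' k) k Z * Real.exp ((footprint Z).card) ≤ Φ')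
    (hE₀ : 0 ≤ E₀) (hcA : 0 ≤ cA) (hcB : 0 ≤ cB) (hc₁ : 0 ≤ c₁) (hr₀ : 0 < r₀) (hδ' : 0 ≤ δ')
    (hθ0 : 0 < θ) (hθ1 : θ < 1) (hθθ' : θ ≤ θ') (hθ'1 : θ' ≤ 1) (hω : 0 < L.ins.ω) (hω1 : L.ins.ω < 1)
    (hh : cA * (EA₀ + E₀) < 1 - L.ins.ω)
    (hsmall : L.ins.ω + Φ' / (1 - 36 * Φ') * cA * (1 - L.ins.ω) / (1 - L.ins.ω - cA * (EA₀ + E₀)) < θ') :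
    ∃ C₅, NE5 (B13StepOfRecord.outA (slotsOfRecordShift D ι c a s P 𝒵 dom Jc V mI L) E₀ cB)
      (B13StepOfRecord.outB (slotsOfRecordShift D ι c a s P 𝒵 dom Jc V mI L) E₀ cB) W κ θ' C₅ :=
  exists_ne5_slotsOfRecordShift_cores_actNorm D ι c a s P 𝒵 dom Jc V mI L
    (measOp T ((Tor (unitMod (D.F.P D.K)) × Fin (D.F.P D.K).d) × o) ι' Ω 𝒴)
    (opA_mem_measOp_slotsOfRecordShift D ι c a s P 𝒵 dom Jc V mI L hbdA hmQA hmRA)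
    (opB_mem_measOp_slotsOfRecordShift D ι c a s P 𝒵 dom Jc V mI L hbdB hmQB hmRB) E₀ cB
    (transportReads_slotsOfRecordShift_of_factor D ι c a s P 𝒵 dom Jc V mI L iopAt hiopA W) hbB hbA hdA hdB hRA hRB hwer hfl hins hOp hroom
    hHist hm hmf hN₀ hNf hqf hH hκ hA0' hdec hΦ0 hsmallΦ hΦ hE₀ hcA hcB hc₁ hr₀ hδ' hθ0 hθ1 hθθ' hθ'1 hω hω1 hh hsmall

end Instance

end Summit.QuantumFields.BalabanUV.T4Continuum.B13AssemblyCoresEndSubstrateShiftMeasOp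

end
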